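import Literature.MathematicalPhysics.QuantumFieldTheory.QCDTransferMatrix
import Summits.QuantumFields.QCD.Theorems.QuarksAsStableActionStableActionBridgeTransferPositivity
import Summits.QuantumFields.QCD.Theorems.QuarksAsStableActionStableActionBridgeGaugeKernelBounds
import Mathlib.MeasureTheory.Function.L2Space
import Mathlib.MeasureTheory.Integral.Prod

/-!
# The `L²` embedding of Smit's transfer matrix is faithful on the two forms
(crux `HeatSlicedQuarks.RobustYangMillsHandover`, item stmt-QuantumFields-8892, line `pin-the-infimum`;
registered sub-goal `transferForms_eq_inner_embed` of the lead skeleton, `--supports stmt-QuantumFields-8892`)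

`Literature/MathematicalPhysics/QuantumFieldTheory/QCDTransferMatrix.lean` renders Smit's transfer matrix of
lattice QCD `T̂ = T̂_F^{1/2} T̂_U T̂_F^{1/2}` (Smit (6.87)) through two sesquilinear forms on continuous
Fock-vector-valued wave functions `Ψ : SU(3)^{Edge 3 S} → (Finset ι → ℂ)` of one time slice: the weighted pairing
`𝔫(Φ, Ψ) = ∫ ⟨Φ(U), T̂_F(U) Ψ(U)⟩ dU` (`fermionWeightForm`) and the transfer form
`𝔱(Φ, Ψ) = ∫∫ K_β(U, U') ⟨T̂_F(U) Φ(U), T̂_F(U') Ψ(U')⟩ dU dU'` (`transferForm`).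

The lead's operator realisation of these forms lives on the Hilbert space `H = L²(ν)`,
`ν = sliceHaar S ⊗ count` on `SU(3)^{Edge 3 S} × J` with `J ≃ Finset ι` a finite measurable index type
(so that `L²(SU(3)^E; Fock) ≅ L²(ν)`), through the embedding `Ψ ↦ fΨ`, `fΨ(U, j) = (R(U) Ψ(U))_{e⁻¹ j}`, where
`R(U)` is a continuous HERMITIAN square root of the fermionic transfer operator, `R(U)² = T̂_F(U)` (given as a
hypothesis), and the transfer operator is ANY bounded `T` agreeing a.e. with the integral operator of scalar kernel
`k((U, s), (U', t)) = K_β(U, U') · (R(U) R(U'))_{st}`.  This file proves the two identities making the embedding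
faithful:

* `⟪fΦ, fΨ⟫ = 𝔫(Φ, Ψ)` — since `⟨R v, R w⟩ = ⟨v, Rᴴ R w⟩ = ⟨v, T̂_F w⟩` pointwise, and the `L²(ν)` inner product is
  `∫ (∑ⱼ conj fΦ(U, j) fΨ(U, j)) dU` (Fubini over `sliceHaar ⊗ count`, the counting factor being a finite sum);
* `⟪fΦ, T fΨ⟫ = 𝔱(Φ, Ψ)` — unfolding the inner product, substituting the a.e. kernel formula, Fubini over `ν`, and
  the regrouping `∑ₛ∑ₜ conj((RΦ)_s) K (R R')_{st} (R'Ψ')_t = K · ⟨R²Φ(U), R'²Ψ(U')⟩ = K · ⟨T̂_F Φ(U), T̂_F Ψ(U')⟩`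
  (`Rᴴ = R`).

All integrability is by continuity on the compact configuration space (times a finite set) and finiteness of
`sliceHaar` (a probability measure) and of `count` on the finite `J`.

References: J. Smit, *Introduction to Quantum Fields on a Lattice* (2023), §6.5 (6.87) [Smit2023]; M. Reed,
B. Simon, *Methods of Modern Mathematical Physics IV*, Thm XIII.1 (the min–max levels these forms feed)
[ReedSimonIV1978].
-/

noncomputable section

open MeasureTheory Matrix Literature.MathematicalPhysics.QuantumFieldTheory
  Literature.MathematicalPhysics.QuantumLattice
open scoped InnerProductSpace ComplexConjugate

namespace Summit.QuantumFields.QCD.Cruxes.RobustYangMillsHandover.PinTheInfimum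

open Summit.QuantumFields.QCD.Cruxes.StableActionBridge.Sketch
  (isProbabilityMeasure_sliceHaar exists_bound_of_continuous_slice integrable_sliceHaar_of_continuous
    continuous_gaugeSliceKernel)

namespace TransferFormsEmbed

/-! ### Pointwise (Fock-space) identities -/

/-- `⟨A v, A w⟩ = ⟨v, A² w⟩` for a Hermitian matrix `A` (`⟨u, v⟩ = star u ⬝ᵥ v`). [folklore] -/
theorem star_mulVec_dotProduct_mulVec {n : Type*} [Fintype n] {A : Matrix n n ℂ} (hA : Aᴴ = A)
    (v w : n → ℂ) : star (A *ᵥ v) ⬝ᵥ (A *ᵥ w) = star v ⬝ᵥ ((A * A) *ᵥ w) := by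
  rw [Matrix.star_mulVec, ← Matrix.dotProduct_mulVec, Matrix.mulVec_mulVec, hA]

/-- `⟨A v, (A B) w⟩ = ⟨A² v, B w⟩` for a Hermitian matrix `A`. [folklore] -/
theorem star_mulVec_dotProduct_mul_mulVec {n : Type*} [Fintype n] {A : Matrix n n ℂ} (hA : Aᴴ = A)
    (B : Matrix n n ℂ) (v w : n → ℂ) :
    star (A *ᵥ v) ⬝ᵥ ((A * B) *ᵥ w) = star ((A * A) *ᵥ v) ⬝ᵥ (B *ᵥ w) := by
  rw [Matrix.star_mulVec, Matrix.star_mulVec, ← Matrix.dotProduct_mulVec, ← Matrix.dotProduct_mulVec,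
    Matrix.mulVec_mulVec, Matrix.mulVec_mulVec, Matrix.conjTranspose_mul, hA, Matrix.mul_assoc]

/-- `∑ᵢ conj (x i) · y i = star x ⬝ᵥ y`. [folklore] -/
theorem sum_conj_mul_eq_star_dotProduct {n : Type*} [Fintype n] (x y : n → ℂ) :
    ∑ i, conj (x i) * y i = star x ⬝ᵥ y := by
  simp only [dotProduct, Pi.star_apply, Complex.star_def]

/-- The regrouping behind `⟪fΦ, T fΨ⟫ = 𝔱(Φ, Ψ)`: for Hermitian `A`,
`∑ₛ conj((A v)_s) ∑ₜ k (A A')_{st} (A' w)_t = k · ⟨A² v, A'² w⟩`. [folklore] -/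
theorem sum_conj_mulVec_mul_sum {n : Type*} [Fintype n] {A : Matrix n n ℂ} (hA : Aᴴ = A)
    (A' : Matrix n n ℂ) (k : ℂ) (v w : n → ℂ) :
    ∑ s, conj ((A *ᵥ v) s) * ∑ t, k * (A * A') s t * (A' *ᵥ w) t =
      k * (star ((A * A) *ᵥ v) ⬝ᵥ ((A' * A') *ᵥ w)) := by
  have h : ∀ s, ∑ t, k * (A * A') s t * (A' *ᵥ w) t = k * ((A * A') *ᵥ (A' *ᵥ w)) s := by
    intro s
    rw [Matrix.mulVec_apply_eq_sum (A * A') (A' *ᵥ w) s, Finset.mul_sum]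
    simp_rw [mul_assoc]
  simp_rw [h, mul_left_comm _ k, ← Finset.mul_sum, sum_conj_mul_eq_star_dotProduct,
    star_mulVec_dotProduct_mul_mulVec hA, Matrix.mulVec_mulVec]

/-! ### Integration against `μ ⊗ count` on a finite index type -/

/-- A function on `X × J` (`J` finite with measurable singletons) with measurable sections and a uniform bound is
integrable for `μ ⊗ count`, `μ` finite. [folklore] -/
theorem integrable_prod_count_of_bounded {X J : Type*} [MeasurableSpace X] [MeasurableSpace J] [Fintype J]
    [MeasurableSingletonClass J] (μ : Measure X) [IsFiniteMeasure μ] {F : X × J → ℂ}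
    (hF : ∀ j, Measurable fun x => F (x, j)) {C : ℝ} (hC : ∀ p, ‖F p‖ ≤ C) :
    Integrable F (μ.prod (Measure.count : Measure J)) :=
  Integrable.of_bound (measurable_from_prod_countable_left hF).aestronglyMeasurable C
    (Filter.Eventually.of_forall hC)

/-- Fubini for `μ ⊗ count` on a finite index type: `∫ F d(μ ⊗ count) = ∫ ∑ⱼ F(x, j) dμ(x)`. [folklore] -/
theorem integral_prod_count_eq_integral_sum {X J : Type*} [MeasurableSpace X] [MeasurableSpace J] [Fintype J]
    [MeasurableSingletonClass J] (μ : Measure X) [IsFiniteMeasure μ] {F : X × J → ℂ}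
    (hF : Integrable F (μ.prod (Measure.count : Measure J))) :
    ∫ p, F p ∂(μ.prod (Measure.count : Measure J)) = ∫ x, ∑ j, F (x, j) ∂μ := by
  rw [integral_prod F hF]
  simp only [integral_count]

/-- A continuous doubly-indexed family on a compact space is uniformly bounded. [folklore] -/
theorem exists_bound_of_continuous₂ {X : Type*} [TopologicalSpace X] [CompactSpace X] {ι κ : Type*}
    [Fintype ι] [Fintype κ] {f : X → ι → κ → ℂ} (hf : Continuous f) : ∃ C : ℝ, ∀ x i j, ‖f x i j‖ ≤ C := by
  obtain ⟨C, hC⟩ := isCompact_univ.exists_bound_of_continuousOn hf.continuousOn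
  exact ⟨C, fun x i j =>
    ((norm_le_pi_norm (f x i) j).trans (norm_le_pi_norm (f x) i)).trans (hC x (Set.mem_univ x))⟩

/-- A continuous indexed family on a compact space is uniformly bounded. [folklore] -/
theorem exists_bound_of_continuous₁ {X : Type*} [TopologicalSpace X] [CompactSpace X] {ι : Type*}
    [Fintype ι] {f : X → ι → ℂ} (hf : Continuous f) : ∃ C : ℝ, ∀ x i, ‖f x i‖ ≤ C := by
  obtain ⟨C, hC⟩ := isCompact_univ.exists_bound_of_continuousOn hf.continuousOn
  exact ⟨C, fun x i => (norm_le_pi_norm (f x) i).trans (hC x (Set.mem_univ x))⟩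

/-! ### The two identities -/

/-- **`⟪fΦ, fΨ⟫ = 𝔫(Φ, Ψ)`**: the `L²(sliceHaar ⊗ count)` inner product of the embedded waves
`fΨ(U, j) = (R(U)Ψ(U))_{e⁻¹ j}` is the `T̂_F`-weighted pairing, for a continuous Hermitian `R` with
`R(U)² = T̂_F(U)`. [cite: Smit2023, §6.5 (6.87)] -/
theorem inner_embed_eq_fermionWeightForm (Nf S : ℕ) [NeZero S] (mq : Fin Nf → ℝ)
    (J : Type) [Fintype J] [MeasurableSpace J] [MeasurableSingletonClass J]
    (e : Finset (SliceFermiIdx Nf S) ≃ J)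
    (R : GaugeConfig 3 S (specialUnitaryGroup (Fin 3) ℂ) →
      Matrix (Finset (SliceFermiIdx Nf S)) (Finset (SliceFermiIdx Nf S)) ℂ)
    (hR : Continuous R) (hRh : ∀ U, (R U)ᴴ = R U) (hRsq : ∀ U, R U * R U = fermionSliceOp U mq)
    (Φ Ψ : SliceWave Nf S) (hΦ : Continuous Φ) (hΨ : Continuous Ψ)
    (fΦ fΨ : Lp ℂ 2 ((sliceHaar S).prod (Measure.count : Measure J)))
    (hfΦ : (fΦ : GaugeConfig 3 S (specialUnitaryGroup (Fin 3) ℂ) × J → ℂ)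
      =ᵐ[(sliceHaar S).prod (Measure.count : Measure J)] fun p => (R p.1 *ᵥ Φ p.1) (e.symm p.2))
    (hfΨ : (fΨ : GaugeConfig 3 S (specialUnitaryGroup (Fin 3) ℂ) × J → ℂ)
      =ᵐ[(sliceHaar S).prod (Measure.count : Measure J)] fun p => (R p.1 *ᵥ Ψ p.1) (e.symm p.2)) :
    ⟪fΦ, fΨ⟫_ℂ = fermionWeightForm mq Φ Ψ := by
  haveI := isProbabilityMeasure_sliceHaar S
  have ha : Continuous fun U => R U *ᵥ Φ U := hR.matrix_mulVec hΦ
  have hb : Continuous fun U => R U *ᵥ Ψ U := hR.matrix_mulVec hΨ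
  -- the integrand `conj (RΦ)_i · (RΨ)_i`, continuous into `ι → ℂ`, hence bounded
  have hF : Continuous fun U i => conj ((R U *ᵥ Φ U) i) * (R U *ᵥ Ψ U) i :=
    continuous_pi fun i =>
      (Complex.continuous_conj.comp ((continuous_apply i).comp ha)).mul ((continuous_apply i).comp hb)
  obtain ⟨C, hC⟩ := exists_bound_of_continuous₁ hF
  have hint : Integrable (fun p : GaugeConfig 3 S (specialUnitaryGroup (Fin 3) ℂ) × J =>
      conj ((R p.1 *ᵥ Φ p.1) (e.symm p.2)) * (R p.1 *ᵥ Ψ p.1) (e.symm p.2))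
      ((sliceHaar S).prod (Measure.count : Measure J)) :=
    integrable_prod_count_of_bounded (sliceHaar S)
      (fun j => ((continuous_apply (e.symm j)).comp hF).measurable) fun p => hC p.1 (e.symm p.2)
  have hae : (fun p => conj ((fΦ : GaugeConfig 3 S (specialUnitaryGroup (Fin 3) ℂ) × J → ℂ) p) *
      (fΨ : GaugeConfig 3 S (specialUnitaryGroup (Fin 3) ℂ) × J → ℂ) p)
        =ᵐ[(sliceHaar S).prod (Measure.count : Measure J)]
      fun p => conj ((R p.1 *ᵥ Φ p.1) (e.symm p.2)) * (R p.1 *ᵥ Ψ p.1) (e.symm p.2) := by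
    filter_upwards [hfΦ, hfΨ] with p h1 h2
    rw [h1, h2]
  rw [L2.inner_def]
  simp only [RCLike.inner_apply']
  rw [integral_congr_ae hae, integral_prod_count_eq_integral_sum _ hint, fermionWeightForm]
  refine integral_congr_ae (ae_of_all _ fun U => ?_)
  dsimp only
  calc ∑ j, conj ((R U *ᵥ Φ U) (e.symm j)) * (R U *ᵥ Ψ U) (e.symm j)
      = ∑ i, conj ((R U *ᵥ Φ U) i) * (R U *ᵥ Ψ U) i :=
        Fintype.sum_equiv e.symm _ (fun i => conj ((R U *ᵥ Φ U) i) * (R U *ᵥ Ψ U) i) fun _ => rfl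
    _ = star (Φ U) ⬝ᵥ (fermionSliceOp U mq *ᵥ Ψ U) := by
        rw [sum_conj_mul_eq_star_dotProduct, star_mulVec_dotProduct_mulVec (hRh U), hRsq U]

/-- **`⟪fΦ, T fΨ⟫ = 𝔱(Φ, Ψ)`** for any bounded `T` on `L²(sliceHaar ⊗ count)` agreeing a.e. with the
integral operator of kernel `k((U,s),(U',t)) = K_β(U,U') (R(U)R(U'))_{st}`: the operator realisation of
Smit's `T̂ = T̂_F^{1/2} T̂_U T̂_F^{1/2}` on the embedded waves reproduces the transfer form.
[cite: Smit2023, §6.5 (6.87)] -/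
theorem inner_transferOp_embed_eq_transferForm (Nf S : ℕ) [NeZero S] (β : ℝ) (mq : Fin Nf → ℝ)
    (J : Type) [Fintype J] [MeasurableSpace J] [MeasurableSingletonClass J]
    (e : Finset (SliceFermiIdx Nf S) ≃ J)
    (R : GaugeConfig 3 S (specialUnitaryGroup (Fin 3) ℂ) →
      Matrix (Finset (SliceFermiIdx Nf S)) (Finset (SliceFermiIdx Nf S)) ℂ)
    (hR : Continuous R) (hRh : ∀ U, (R U)ᴴ = R U) (hRsq : ∀ U, R U * R U = fermionSliceOp U mq)
    (Φ Ψ : SliceWave Nf S) (hΦ : Continuous Φ) (hΨ : Continuous Ψ)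
    (fΦ fΨ : Lp ℂ 2 ((sliceHaar S).prod (Measure.count : Measure J)))
    (hfΦ : (fΦ : GaugeConfig 3 S (specialUnitaryGroup (Fin 3) ℂ) × J → ℂ)
      =ᵐ[(sliceHaar S).prod (Measure.count : Measure J)] fun p => (R p.1 *ᵥ Φ p.1) (e.symm p.2))
    (hfΨ : (fΨ : GaugeConfig 3 S (specialUnitaryGroup (Fin 3) ℂ) × J → ℂ)
      =ᵐ[(sliceHaar S).prod (Measure.count : Measure J)] fun p => (R p.1 *ᵥ Ψ p.1) (e.symm p.2))
    (T : Lp ℂ 2 ((sliceHaar S).prod (Measure.count : Measure J)) →L[ℂ]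
      Lp ℂ 2 ((sliceHaar S).prod (Measure.count : Measure J)))
    (hT : ∀ φ : Lp ℂ 2 ((sliceHaar S).prod (Measure.count : Measure J)),
      (T φ : GaugeConfig 3 S (specialUnitaryGroup (Fin 3) ℂ) × J → ℂ)
        =ᵐ[(sliceHaar S).prod (Measure.count : Measure J)] fun p =>
          ∫ q, (gaugeSliceKernel β p.1 q.1 : ℂ) * (R p.1 * R q.1) (e.symm p.2) (e.symm q.2) * φ q
            ∂((sliceHaar S).prod (Measure.count : Measure J))) :
    ⟪fΦ, T fΨ⟫_ℂ = transferForm β mq Φ Ψ := by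
  haveI := isProbabilityMeasure_sliceHaar S
  -- continuity atoms
  have ha : Continuous fun U => R U *ᵥ Φ U := hR.matrix_mulVec hΦ
  have hb : Continuous fun U => R U *ᵥ Ψ U := hR.matrix_mulVec hΨ
  have hK : Continuous fun p : GaugeConfig 3 S (specialUnitaryGroup (Fin 3) ℂ) ×
      GaugeConfig 3 S (specialUnitaryGroup (Fin 3) ℂ) => (gaugeSliceKernel β p.1 p.2 : ℂ) :=
    Complex.continuous_ofReal.comp (continuous_gaugeSliceKernel S β)
  have hRR : Continuous fun p : GaugeConfig 3 S (specialUnitaryGroup (Fin 3) ℂ) ×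
      GaugeConfig 3 S (specialUnitaryGroup (Fin 3) ℂ) => R p.1 * R p.2 :=
    (hR.comp continuous_fst).matrix_mul (hR.comp continuous_snd)
  -- the kernel integrand `K (R R')_{st} (R'Ψ')_t`, continuous `G × G → ι → ι → ℂ`, hence bounded
  have hk : Continuous fun (p : GaugeConfig 3 S (specialUnitaryGroup (Fin 3) ℂ) ×
      GaugeConfig 3 S (specialUnitaryGroup (Fin 3) ℂ)) (s t : Finset (SliceFermiIdx Nf S)) =>
        (gaugeSliceKernel β p.1 p.2 : ℂ) * (R p.1 * R p.2) s t * (R p.2 *ᵥ Ψ p.2) t :=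
    continuous_pi fun s => continuous_pi fun t =>
      (hK.mul (hRR.matrix_elem s t)).mul (((continuous_apply t).comp hb).comp continuous_snd)
  obtain ⟨Ck, hCk⟩ := exists_bound_of_continuous₂ hk
  -- its `t`-sum, continuous `G × G → ι → ℂ`, hence bounded
  have hL : Continuous fun (p : GaugeConfig 3 S (specialUnitaryGroup (Fin 3) ℂ) ×
      GaugeConfig 3 S (specialUnitaryGroup (Fin 3) ℂ)) (s : Finset (SliceFermiIdx Nf S)) =>
        ∑ t, (gaugeSliceKernel β p.1 p.2 : ℂ) * (R p.1 * R p.2) s t * (R p.2 *ᵥ Ψ p.2) t :=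
    continuous_pi fun s => continuous_finsetSum _ fun t _ =>
      (continuous_apply t).comp ((continuous_apply s).comp hk)
  obtain ⟨CL, hCL⟩ := exists_bound_of_continuous₁ hL
  obtain ⟨Ca, hCa⟩ := exists_bound_of_continuous₁ ha
  -- Step 1: the inner (kernel) integral against the embedded wave, for every `(U, s)`
  have hinner : ∀ (U : GaugeConfig 3 S (specialUnitaryGroup (Fin 3) ℂ)) (s : Finset (SliceFermiIdx Nf S)),
      ∫ q, (gaugeSliceKernel β U q.1 : ℂ) * (R U * R q.1) s (e.symm q.2) * (R q.1 *ᵥ Ψ q.1) (e.symm q.2)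
          ∂((sliceHaar S).prod (Measure.count : Measure J)) =
        ∫ U', ∑ t, (gaugeSliceKernel β U U' : ℂ) * (R U * R U') s t * (R U' *ᵥ Ψ U') t ∂(sliceHaar S) := by
    intro U s
    have hint : Integrable (fun q : GaugeConfig 3 S (specialUnitaryGroup (Fin 3) ℂ) × J =>
        (gaugeSliceKernel β U q.1 : ℂ) * (R U * R q.1) s (e.symm q.2) * (R q.1 *ᵥ Ψ q.1) (e.symm q.2))
        ((sliceHaar S).prod (Measure.count : Measure J)) :=
      integrable_prod_count_of_bounded (sliceHaar S)
        (fun j => ((continuous_apply (e.symm j)).comp ((continuous_apply s).comp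
          (hk.comp (Continuous.prodMk_right U)))).measurable)
        fun q => hCk (U, q.1) s (e.symm q.2)
    rw [integral_prod_count_eq_integral_sum _ hint]
    refine integral_congr_ae (ae_of_all _ fun U' => ?_)
    exact Fintype.sum_equiv e.symm _ _ fun _ => rfl
  -- Step 2: the integrand of `⟪fΦ, T fΨ⟫`, almost everywhere
  have hae : (fun p => conj ((fΦ : GaugeConfig 3 S (specialUnitaryGroup (Fin 3) ℂ) × J → ℂ) p) *
      ((T fΨ : Lp ℂ 2 ((sliceHaar S).prod (Measure.count : Measure J))) :
        GaugeConfig 3 S (specialUnitaryGroup (Fin 3) ℂ) × J → ℂ) p)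
        =ᵐ[(sliceHaar S).prod (Measure.count : Measure J)]
      fun p => conj ((R p.1 *ᵥ Φ p.1) (e.symm p.2)) *
        ∫ U', ∑ t, (gaugeSliceKernel β p.1 U' : ℂ) * (R p.1 * R U') (e.symm p.2) t * (R U' *ᵥ Ψ U') t
          ∂(sliceHaar S) := by
    filter_upwards [hfΦ, hT fΨ] with p h1 h2
    rw [h1, h2, ← hinner p.1 (e.symm p.2)]
    congr 1
    refine integral_congr_ae ?_
    filter_upwards [hfΨ] with q hq
    rw [hq]
  -- Step 3: measurability and boundedness of the outer integrand
  have hI : ∀ s : Finset (SliceFermiIdx Nf S), StronglyMeasurable fun U =>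
      ∫ U', ∑ t, (gaugeSliceKernel β U U' : ℂ) * (R U * R U') s t * (R U' *ᵥ Ψ U') t ∂(sliceHaar S) :=
    fun s => StronglyMeasurable.integral_prod_right
      (f := fun U U' => ∑ t, (gaugeSliceKernel β U U' : ℂ) * (R U * R U') s t * (R U' *ᵥ Ψ U') t)
      ((continuous_apply s).comp hL).stronglyMeasurable
  have hIb : ∀ (U : GaugeConfig 3 S (specialUnitaryGroup (Fin 3) ℂ)) (s : Finset (SliceFermiIdx Nf S)),
      ‖∫ U', ∑ t, (gaugeSliceKernel β U U' : ℂ) * (R U * R U') s t * (R U' *ᵥ Ψ U') t ∂(sliceHaar S)‖ ≤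
        CL * (sliceHaar S).real Set.univ :=
    fun U s => norm_integral_le_of_norm_le_const (ae_of_all _ fun U' => hCL (U, U') s)
  have hint2 : Integrable (fun p : GaugeConfig 3 S (specialUnitaryGroup (Fin 3) ℂ) × J =>
      conj ((R p.1 *ᵥ Φ p.1) (e.symm p.2)) *
        ∫ U', ∑ t, (gaugeSliceKernel β p.1 U' : ℂ) * (R p.1 * R U') (e.symm p.2) t * (R U' *ᵥ Ψ U') t
          ∂(sliceHaar S)) ((sliceHaar S).prod (Measure.count : Measure J)) := by
    refine integrable_prod_count_of_bounded (sliceHaar S)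
      (fun j => (Complex.continuous_conj.comp ((continuous_apply (e.symm j)).comp ha)).measurable.mul
        (hI (e.symm j)).measurable)
      (C := Ca * (CL * (sliceHaar S).real Set.univ)) fun p => ?_
    rw [norm_mul, Complex.norm_conj]
    exact mul_le_mul (hCa p.1 (e.symm p.2)) (hIb p.1 (e.symm p.2)) (norm_nonneg _)
      ((norm_nonneg _).trans (hCa p.1 (e.symm p.2)))
  -- Step 4: assemble (Fubini over `sliceHaar ⊗ count`, then regroup the double sum pointwise)
  rw [L2.inner_def]
  simp only [RCLike.inner_apply']
  rw [integral_congr_ae hae, integral_prod_count_eq_integral_sum _ hint2, transferForm]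
  refine integral_congr_ae (ae_of_all _ fun U => ?_)
  dsimp only
  have hsum : ∀ s : Finset (SliceFermiIdx Nf S), Integrable (fun U' => conj ((R U *ᵥ Φ U) s) *
      ∑ t, (gaugeSliceKernel β U U' : ℂ) * (R U * R U') s t * (R U' *ᵥ Ψ U') t) (sliceHaar S) :=
    fun s => integrable_sliceHaar_of_continuous
      (continuous_const.mul ((continuous_apply s).comp (hL.comp (Continuous.prodMk_right U))))
  calc ∑ j, conj ((R U *ᵥ Φ U) (e.symm j)) *
        ∫ U', ∑ t, (gaugeSliceKernel β U U' : ℂ) * (R U * R U') (e.symm j) t * (R U' *ᵥ Ψ U') t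
          ∂(sliceHaar S)
      = ∑ s, conj ((R U *ᵥ Φ U) s) *
        ∫ U', ∑ t, (gaugeSliceKernel β U U' : ℂ) * (R U * R U') s t * (R U' *ᵥ Ψ U') t ∂(sliceHaar S) :=
        Fintype.sum_equiv e.symm _ (fun s => conj ((R U *ᵥ Φ U) s) *
          ∫ U', ∑ t, (gaugeSliceKernel β U U' : ℂ) * (R U * R U') s t * (R U' *ᵥ Ψ U') t ∂(sliceHaar S))
          fun _ => rfl
    _ = ∫ U', ∑ s, conj ((R U *ᵥ Φ U) s) *
        ∑ t, (gaugeSliceKernel β U U' : ℂ) * (R U * R U') s t * (R U' *ᵥ Ψ U') t ∂(sliceHaar S) := by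
        rw [integral_finsetSum _ fun s _ => hsum s]
        simp_rw [integral_const_mul]
    _ = ∫ U', (gaugeSliceKernel β U U' : ℂ) *
        (star (fermionSliceOp U mq *ᵥ Φ U) ⬝ᵥ (fermionSliceOp U' mq *ᵥ Ψ U')) ∂(sliceHaar S) := by
        refine integral_congr_ae (ae_of_all _ fun U' => ?_)
        dsimp only
        rw [sum_conj_mulVec_mul_sum (hRh U), hRsq U, hRsq U']

end TransferFormsEmbed

open TransferFormsEmbed

/-- **The `L²` embedding is faithful on both forms** (registered sub-goal `transferForms_eq_inner_embed` of line
`pin-the-infimum`): for a continuous Hermitian `R` with `R(U)² = T̂_F(U)`, continuous waves `Φ, Ψ` embedded as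
`fΨ(U, j) = (R(U)Ψ(U))_{e⁻¹ j}` in `L²(sliceHaar ⊗ count)`, `⟪fΦ, fΨ⟫ = 𝔫(Φ, Ψ)`, and for any bounded `T` agreeing
a.e. with the integral operator of kernel `K_β(U,U') (R(U)R(U'))_{st}`, `⟪fΦ, T fΨ⟫ = 𝔱(Φ, Ψ)` — the operator
form of Smit's `T̂ = T̂_F^{1/2} T̂_U T̂_F^{1/2}`. [cite: Smit2023, §6.5 (6.87)] -/
theorem transferForms_eq_inner_embed : ∀ (Nf S : ℕ) [NeZero S] (β : ℝ) (mq : Fin Nf → ℝ) (J : Type) [Fintype J] [MeasurableSpace J] [MeasurableSingletonClass J] (e : Finset (SliceFermiIdx Nf S) ≃ J) (R : GaugeConfig 3 S (Matrix.specialUnitaryGroup (Fin 3) ℂ) → Matrix (Finset (SliceFermiIdx Nf S)) (Finset (SliceFermiIdx Nf S)) ℂ), Continuous R → (∀ U, (R U)ᴴ = R U) → (∀ U, R U * R U = fermionSliceOp U mq) → ∀ (Φ Ψ : SliceWave Nf S), Continuous Φ → Continuous Ψ → ∀ (fΦ fΨ : Lp ℂ 2 ((sliceHaar S).prod (Measure.count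 : Measure J))), ((fΦ : GaugeConfig 3 S (Matrix.specialUnitaryGroup (Fin 3) ℂ) × J → ℂ) =ᵐ[(sliceHaar S).prod (Measure.count : Measure J)] fun p => (R p.1 *ᵥ Φ p.1) (e.symm p.2)) → ((fΨ : GaugeConfig 3 S (Matrix.specialUnitaryGroup (Fin 3) ℂ) × J → ℂ) =ᵐ[(sliceHaar S).prod (Measure.count : Measure J)] fun p => (R p.1 *ᵥ Ψ p.1) (e.symm p.2)) → ⟪fΦ, fΨ⟫_ℂ = fermionWeightForm mq Φ Ψ ∧ ∀ T : Lp ℂ 2 ((sliceHaar S).prod (Measure.count : Measure J)) →L[ℂ] Lp ℂ 2 ((sliceHaar S).prod (Measure.count : Measure J)), (∀ φ : Lp ℂ 2 ((sliceHaar S).prod (Measure.count : Measure J)), (T φ : GaugeConfig 3 S (Matrix.specialUnitaryGroup (Fin 3) ℂ) × J → ℂ) =ᵐ[(sliceHaar S).prod (Measure.count : Measure J)] fun p => ∫ q, (gaugeSliceKernel β p.1 q.1 : ℂ) * (R p.1 * R q.1) (e.symm p.2) (e.symm q.2) * φ q ∂((sliceHaar S).prod (Measure.count : Measure J))) → ⟪fΦ,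 T fΨ⟫_ℂ = transferForm β mq Φ Ψ := by
  intro Nf S _ β mq J _ _ _ e R hR hRh hRsq Φ Ψ hΦ hΨ fΦ fΨ hfΦ hfΨ
  exact ⟨inner_embed_eq_fermionWeightForm Nf S mq J e R hR hRh hRsq Φ Ψ hΦ hΨ fΦ fΨ hfΦ hfΨ,
    fun T hT => inner_transferOp_embed_eq_transferForm Nf S β mq J e R hR hRh hRsq Φ Ψ hΦ hΨ fΦ fΨ
      hfΦ hfΨ T hT⟩

end Summit.QuantumFields.QCD.Cruxes.RobustYangMillsHandover.PinTheInfimum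

end
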